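import Summits.RiemannHypothesis.RiemannHypothesis.Theorems.WeilWindowFlowWindowLipschitzStubLocalizedCutAux2
import Literature.NumberTheory.LFunctions.WeilSemilocalCompactnessProofs

/-!
# Stub `stub_localizedCut` of line `cut-dont-squeeze` for crux `WeilWindowFlow.WindowLipschitz`
(item stmt-RiemannHypothesis-1039, route route-RiemannHypothesis-WeilWindowFlow; registered skeleton
rev 4, skeleton file
`Summits/RiemannHypothesis/RiemannHypothesis/Cruxes/WindowLipschitz/Lines/cut-dont-squeeze.lean`)

**What is proved.** `stub_localizedCut` (Stub D, the lever of the line "cut, don't squeeze"): from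
(C1) positivity of the closed form `𝔅_a(f) := P(f) + 𝓔_a(f) − (M_a + ε(a))‖f‖²` on the
finite-energy class of every window (`P = weilPoleForm`, `𝓔_a = weilDirichletEnergy a`,
`M_a = weilMarkovConstant a`, `ε = weilGroundEnergy`), (C2) finite energy and `𝔅_a(u) ≤ 0` for
ground states `u` (`IsWeilGroundState a u`), and (EL) the weak Euler–Lagrange identity of a ground
state against finite-energy `w` supported in the window, we derive for `0 < b ≤ a` and a
`K`-Lipschitz cutoff `χ` with values in `[0, 1]`, `χ = 0` on `|x| ≥ b`:

`(ε(b) − ε(a)) ‖χu‖² ≤ ArchComm + PrimeComm + 2|∫θu ch|² + 2|∫u ch||∫θ²u ch| + 2|∫u sh||∫θ²u sh|`,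

`θ = 1 − χ`, `ch = cosh(t/2)`, `sh = sinh(t/2)`,
`ArchComm = ∫₀^∞ ρ(t) ∫ (χ(x+t) − χ x)² |u(x+t)||u x| dx dt`,
`PrimeComm = Σ_{log n < 2a} Λ(n) n^{-1/2} ∫ (χ(x + log n) − χ x)² |u(x + log n)||u x| dx`.

**Proof route.** (0) Bounded Lipschitz multipliers preserve the finite-energy class
(`D_t(mu) ≤ 2D_t(u) + 2 min(K²t², 1)‖u‖²`, `∫ ρ min < ∞`; Aux part 1), so `χu`, `θu`, `θ²u` are
admissible test directions. (1) (C1) at the window `b` for `χu` and (2) the window change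
`𝓔_b − M_b‖·‖² = 𝓔_a − M_a‖·‖²` on functions vanishing on `|x| ≥ b` give
`(ε(b) − ε(a))‖χu‖² ≤ 𝔅_a(χu)`. (3)–(4) Expanding `χu = u − θu` termwise
(`q(f − g) = q(f) + q(g) − 2 Re q(f, g)`) and inserting the real part of (EL) for `w = θu` and (C2):
`𝔅_a(χu) ≤ 𝔅_a(θu)`. (5) The real part of (EL) for `w = θ²u` (`⟨u, θ²u⟩ = ‖θu‖²`) and the
pointwise IMS identity `|pU − qV|² − Re((U − V) conj(p²U − q²V)) = (p − q)² Re(U conj V)` inside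
every increment bound `𝓔_a(θu) − Re 𝓔_a(u, θ²u)` by `ArchComm + PrimeComm`, and
`P(θu) − Re P(u, θ²u) ≤ 2|∫θu ch|² + 2|∫u ch||∫θ²u ch| + 2|∫u sh||∫θ²u sh|`; the final step is
linear arithmetic in these real quantities.

Sources: E. Bombieri, *Remarks on Weil's quadratic functional in the theory of prime numbers I*,
Rend. Mat. Acc. Lincei (9) 11 (2000), §4 Lemma 1 / (4.2) (the variational equation);
H. Cycon, R. Froese, W. Kirsch, B. Simon, *Schrödinger Operators*, Springer (1987), Thm 3.2
(IMS localisation formula).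
-/

set_option linter.dupNamespace false

noncomputable section

open MeasureTheory Set Filter
open scoped Topology ENNReal NNReal ComplexConjugate ArithmeticFunction.vonMangoldt

namespace Summit.RiemannHypothesis.RiemannHypothesis.Theorems.WeilWindowFlowWindowLipschitz

open Literature.NumberTheory.LFunctions Literature.NumberTheory.LFunctions.ConnesVanSuijlekom

/-- **Stub D `stub_localizedCut` — the localised-cut inequality at a ground state** (line
`cut-dont-squeeze` of the crux `WeilWindowFlow.WindowLipschitz`).  Assume (C1) positivity of the
closed form `𝔅_a(f) := P(f) + 𝓔_a(f) − (M_a + ε(a))‖f‖²` on the finite-energy class of every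
window, (C2) finite energy and `𝔅_a(u) ≤ 0` for ground states, and (EL) the weak Euler–Lagrange
identity `B_a(u, w) = (M_a + ε(a))⟨u, w⟩` of a ground state `u` against every finite-energy `w`
supported in the window (Bombieri's variational equation (4.2), Markov-decomposed).  Then for
`0 < b ≤ a`, a ground state `u` of the window `a` and a `K`-Lipschitz cutoff `χ` with values in
`[0, 1]` vanishing on `|x| ≥ b`,
`(ε(b) − ε(a)) ‖χu‖² ≤ ArchComm + PrimeComm + 2|∫θu ch|² + 2|∫u ch||∫θ²u ch| + 2|∫u sh||∫θ²u sh|`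
(`θ = 1 − χ`, `ch = cosh(t/2)`, `sh = sinh(t/2)`,
`ArchComm = ∫₀^∞ ρ(t) ∫ (χ(x+t) − χ x)² |u(x+t)||u x|`,
`PrimeComm = Σ_{log n < 2a} Λ(n) n^{-1/2} ∫ (χ(x+log n) − χ x)² |u(x+log n)||u x|`).
Proof: bounded Lipschitz multipliers preserve the finite-energy class
(`D_t(mu) ≤ 2D_t(u) + 2 min(K²t², 1)‖u‖²`, `∫ρ min < ∞`), so `χu, θu, θ²u` are admissible;
(C1) at the window `b` for `χu` and the window change `𝓔_b − M_b‖·‖² = 𝓔_a − M_a‖·‖²` on functions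
vanishing on `|x| ≥ b` (`D_{log n}(χu) = 2‖χu‖²` for `2b ≤ log n`) give
`(ε(b) − ε(a))‖χu‖² ≤ 𝔅_a(χu)`;
expanding `χu = u − θu` termwise and using (EL) with `w = θu` and (C2): `𝔅_a(χu) ≤ 𝔅_a(θu)`;
(EL) with `w = θ²u` (`⟨u, θ²u⟩ = ‖θu‖²`) and the pointwise IMS identity
`|pU − qV|² − Re((U − V) conj(p²U − q²V)) = (p − q)² Re(U conj V)` inside every increment bound
`𝓔_a(θu) − Re 𝓔_a(u, θ²u)` by the commutators, and `P(θu) − Re P(u, θ²u)` by the polar remainder.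
(Bombieri 2000, §4 Lemma 1 / (4.2); Cycon–Froese–Kirsch–Simon, *Schrödinger Operators*,
Thm 3.2.) -/
theorem stub_localizedCut :
    (∀ a : ℝ, 0 < a → ∀ f : ℝ → ℂ, MemLp f 2 → (∀ᵐ x : ℝ, x ∉ Icc (-a) a → f x = 0) →
      IntegrableOn (fun t ↦ weilArchDensity t * weilIncrement f t) (Ioi 0) →
        (weilMarkovConstant a + weilGroundEnergy a) * ∫ x, ‖f x‖ ^ 2 ≤
          weilPoleForm f + weilDirichletEnergy a f) →
    (∀ (a : ℝ) (u : ℝ → ℂ), IsWeilGroundState a u →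
      IntegrableOn (fun t ↦ weilArchDensity t * weilIncrement u t) (Ioi 0) ∧
        weilPoleForm u + weilDirichletEnergy a u ≤
          (weilMarkovConstant a + weilGroundEnergy a) * ∫ x, ‖u x‖ ^ 2) →
    (∀ (a : ℝ) (u : ℝ → ℂ), IsWeilGroundState a u →
      ∀ w : ℝ → ℂ, MemLp w 2 → (∀ᵐ x : ℝ, x ∉ Icc (-a) a → w x = 0) →
        IntegrableOn (fun t ↦ weilArchDensity t * weilIncrement w t) (Ioi 0) →
        2 * (∫ x, u x * (Real.cosh (x / 2) : ℂ)) * (starRingEnd ℂ) (∫ x, w x * (Real.cosh (x / 2) : ℂ))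
          - 2 * (∫ x, u x * (Real.sinh (x / 2) : ℂ)) * (starRingEnd ℂ) (∫ x, w x * (Real.sinh (x / 2) : ℂ))
          + (∑ n ∈ weilPrimeIndex a, (((ArithmeticFunction.vonMangoldt n : ℝ) / Real.sqrt n : ℝ) : ℂ) *
              ∫ x, (u (x + Real.log n) - u x) * (starRingEnd ℂ) (w (x + Real.log n) - w x))
          + (∫ t in Ioi (0 : ℝ), (weilArchDensity t : ℂ) *
              ∫ x, (u (x + t) - u x) * (starRingEnd ℂ) (w (x + t) - w x))
          - (weilMarkovConstant a : ℂ) * ∫ x, u x * (starRingEnd ℂ) (w x)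
        = (weilGroundEnergy a : ℂ) * ∫ x, u x * (starRingEnd ℂ) (w x)) →
    ∀ (a b : ℝ) (K : ℝ≥0) (u : ℝ → ℂ) (χ : ℝ → ℝ), 0 < b → b ≤ a → IsWeilGroundState a u →
        LipschitzWith K χ → (∀ x, 0 ≤ χ x ∧ χ x ≤ 1) → (∀ x, b ≤ |x| → χ x = 0) →
        (weilGroundEnergy b - weilGroundEnergy a) * ∫ x, ‖(χ x : ℂ) * u x‖ ^ 2 ≤
          (∫ t in Ioi (0 : ℝ), weilArchDensity t *
              ∫ x, (χ (x + t) - χ x) ^ 2 * (‖u (x + t)‖ * ‖u x‖)) +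
          (∑ n ∈ weilPrimeIndex a, (ArithmeticFunction.vonMangoldt n : ℝ) / Real.sqrt n *
              ∫ x, (χ (x + Real.log n) - χ x) ^ 2 * (‖u (x + Real.log n)‖ * ‖u x‖)) +
          2 * ‖∫ t, ((1 - χ t : ℝ) : ℂ) * u t * (Real.cosh (t / 2) : ℂ)‖ ^ 2 +
          2 * ‖∫ t, u t * (Real.cosh (t / 2) : ℂ)‖ *
              ‖∫ t, (((1 - χ t) ^ 2 : ℝ) : ℂ) * u t * (Real.cosh (t / 2) : ℂ)‖ +
          2 * ‖∫ t, u t * (Real.sinh (t / 2) : ℂ)‖ *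
              ‖∫ t, (((1 - χ t) ^ 2 : ℝ) : ℂ) * u t * (Real.sinh (t / 2) : ℂ)‖ := by
  intro hC1 hC2 hEL a b K u χ hb hba hgs hχ h01 hχb
  -- basic data on `u` and the multipliers `χ`, `θ = 1 − χ`, `θ²`
  have hu : MemLp u 2 := hgs.memLp
  have hχc : Continuous χ := hχ.continuous
  have hK : (0 : ℝ) ≤ K := K.2
  have hχL : ∀ x y, |χ x - χ y| ≤ K * |x - y| := fun x y ↦ by
    have h := hχ.dist_le_mul x y
    rwa [Real.dist_eq, Real.dist_eq] at h
  have hθL : ∀ x y, |(1 - χ x) - (1 - χ y)| ≤ K * |x - y| := fun x y ↦ by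
    rw [show (1 - χ x) - (1 - χ y) = χ y - χ x by ring, abs_sub_comm]
    exact hχL x y
  have hθ2L : ∀ x y, |(1 - χ x) ^ 2 - (1 - χ y) ^ 2| ≤ 2 * K * |x - y| := fun x y ↦ by
    rw [show (1 - χ x) ^ 2 - (1 - χ y) ^ 2 = ((1 - χ x) + (1 - χ y)) * ((1 - χ x) - (1 - χ y))
      by ring, abs_mul]
    have hs : |(1 - χ x) + (1 - χ y)| ≤ 2 := by
      rw [abs_le]
      constructor <;> linarith [(h01 x).1, (h01 x).2, (h01 y).1, (h01 y).2]
    calc |(1 - χ x) + (1 - χ y)| * |(1 - χ x) - (1 - χ y)| ≤ 2 * (K * |x - y|) :=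
          mul_le_mul hs (hθL x y) (abs_nonneg _) zero_le_two
      _ = 2 * K * |x - y| := by ring
  have h01θ : ∀ x, 0 ≤ 1 - χ x ∧ 1 - χ x ≤ 1 := fun x ↦
    ⟨by linarith [(h01 x).2], by linarith [(h01 x).1]⟩
  have h01θ2 : ∀ x, 0 ≤ (1 - χ x) ^ 2 ∧ (1 - χ x) ^ 2 ≤ 1 := fun x ↦
    ⟨sq_nonneg _, by nlinarith [(h01θ x).1, (h01θ x).2]⟩
  -- `L²` membership of `χu`, `θu`, `θ²u`
  have hχm : MemLp (fun x ↦ (χ x : ℂ) * u x) 2 :=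
    stub_localizedCut_memLp_mul hu hχc fun x ↦ abs_le.2 ⟨by linarith [(h01 x).1], (h01 x).2⟩
  have hθm : MemLp (fun x ↦ ((1 - χ x : ℝ) : ℂ) * u x) 2 :=
    stub_localizedCut_memLp_mul hu (by fun_prop) fun x ↦
      abs_le.2 ⟨by linarith [(h01θ x).1], (h01θ x).2⟩
  have hθ2m : MemLp (fun x ↦ (((1 - χ x) ^ 2 : ℝ) : ℂ) * u x) 2 :=
    stub_localizedCut_memLp_mul hu (by fun_prop) fun x ↦
      abs_le.2 ⟨by linarith [(h01θ2 x).1], (h01θ2 x).2⟩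
  -- finite energies (C2 for `u`; bounded Lipschitz multipliers preserve finite energy)
  obtain ⟨hfinU, F7⟩ := hC2 a u hgs
  have hfinχ : IntegrableOn
      (fun t ↦ weilArchDensity t * weilIncrement (fun x ↦ (χ x : ℂ) * u x) t) (Ioi 0) :=
    stub_localizedCut_finiteEnergy_mul hu hχc h01 hK hχL hfinU
  have hfinθ : IntegrableOn
      (fun t ↦ weilArchDensity t * weilIncrement (fun x ↦ ((1 - χ x : ℝ) : ℂ) * u x) t) (Ioi 0) :=
    stub_localizedCut_finiteEnergy_mul (m := fun x ↦ 1 - χ x) hu (by fun_prop) h01θ hK hθL hfinU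
  have hfinθ2 : IntegrableOn
      (fun t ↦ weilArchDensity t * weilIncrement (fun x ↦ (((1 - χ x) ^ 2 : ℝ) : ℂ) * u x) t)
      (Ioi 0) :=
    stub_localizedCut_finiteEnergy_mul (m := fun x ↦ (1 - χ x) ^ 2) hu (by fun_prop) h01θ2
      (by positivity) hθ2L hfinU
  -- supports
  have hθvan : ∀ᵐ x : ℝ, x ∉ Icc (-a) a → ((1 - χ x : ℝ) : ℂ) * u x = 0 :=
    hgs.ae_eq_zero_of_notMem.mono fun x hx hxa ↦ by rw [hx hxa, mul_zero]
  have hθ2van : ∀ᵐ x : ℝ, x ∉ Icc (-a) a → (((1 - χ x) ^ 2 : ℝ) : ℂ) * u x = 0 :=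
    hgs.ae_eq_zero_of_notMem.mono fun x hx hxa ↦ by rw [hx hxa, mul_zero]
  have hχsupp : ∀ x, b ≤ |x| → (χ x : ℂ) * u x = 0 := fun x hx ↦ by
    rw [hχb x hx, Complex.ofReal_zero, zero_mul]
  have hχvan : ∀ᵐ x : ℝ, x ∉ Icc (-b) b → (χ x : ℂ) * u x = 0 :=
    ae_of_all _ fun x hx ↦ hχsupp x (by
      by_contra h
      have h' := abs_lt.1 (not_le.1 h)
      exact hx ⟨h'.1.le, h'.2.le⟩)
  -- (C1) at the window `b` and the window change
  have F1 := hC1 b hb (fun x ↦ (χ x : ℂ) * u x) hχm hχvan hfinχ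
  have F2 := stub_localizedCut_energy_window (a := a) hχm hba hχsupp
  beta_reduce at F1 F2
  -- the Euler–Lagrange identities for `w = θu` and `w = θ²u`, real parts
  have F6 := congrArg Complex.re
    (hEL a u hgs (fun x ↦ ((1 - χ x : ℝ) : ℂ) * u x) hθm hθvan hfinθ)
  have F8 := congrArg Complex.re
    (hEL a u hgs (fun x ↦ (((1 - χ x) ^ 2 : ℝ) : ℂ) * u x) hθ2m hθ2van hfinθ2)
  simp only [Complex.sub_re, Complex.add_re, Complex.re_sum, Complex.re_ofReal_mul] at F6 F8
  -- `⟨u, θ²u⟩ = ‖θu‖²`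
  have hinner : (∫ x, u x * conj ((((1 - χ x) ^ 2 : ℝ) : ℂ) * u x)).re =
      ∫ x, ‖((1 - χ x : ℝ) : ℂ) * u x‖ ^ 2 := by
    have hI : Integrable fun x ↦ u x * conj ((((1 - χ x) ^ 2 : ℝ) : ℂ) * u x) :=
      hu.integrable_mul (memLp_conj hθ2m)
    rw [← stub_localizedCut_integral_re hI]
    refine integral_congr_ae (ae_of_all _ fun x ↦ ?_)
    beta_reduce
    rw [norm_mul, mul_pow, Complex.norm_real, Real.norm_eq_abs, sq_abs, ← Complex.normSq_eq_norm_sq,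
      Complex.normSq_apply]
    simp only [map_mul, Complex.conj_ofReal, Complex.mul_re, Complex.mul_im, Complex.ofReal_re,
      Complex.ofReal_im, Complex.conj_re, Complex.conj_im]
    ring
  -- integrability of the pole vectors
  have huc : Integrable fun x ↦ u x * (Real.cosh (x / 2) : ℂ) :=
    hgs.integrable_mul_continuous (by fun_prop)
  have hus : Integrable fun x ↦ u x * (Real.sinh (x / 2) : ℂ) :=
    hgs.integrable_mul_continuous (by fun_prop)
  have hθc' : Integrable fun x ↦ ((1 - χ x : ℝ) : ℂ) * u x * (Real.cosh (x / 2) : ℂ) :=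
    (hgs.integrable_mul_continuous (w := fun x ↦ ((1 - χ x : ℝ) : ℂ) * (Real.cosh (x / 2) : ℂ))
      (by fun_prop)).congr (ae_of_all _ fun x ↦ by ring)
  have hθs' : Integrable fun x ↦ ((1 - χ x : ℝ) : ℂ) * u x * (Real.sinh (x / 2) : ℂ) :=
    (hgs.integrable_mul_continuous (w := fun x ↦ ((1 - χ x : ℝ) : ℂ) * (Real.sinh (x / 2) : ℂ))
      (by fun_prop)).congr (ae_of_all _ fun x ↦ by ring)
  -- expansions of `χu = u − θu`
  have hχθ : (fun x ↦ (χ x : ℂ) * u x) = fun x ↦ u x - ((1 - χ x : ℝ) : ℂ) * u x := by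
    funext x
    push_cast
    ring
  have F3 := stub_localizedCut_weilPoleForm_sub huc hθc' hus hθs'
  have F4 := stub_localizedCut_weilDirichletEnergy_sub a hu hθm hfinU hfinθ
  have F5 := stub_localizedCut_integral_norm_sq_sub hu hθm
  beta_reduce at F3 F4 F5
  rw [← hχθ] at F3 F4
  have F5' := congrArg (fun f : ℝ → ℂ ↦ ∫ x, ‖f x‖ ^ 2) hχθ
  beta_reduce at F5'
  rw [F5] at F5'
  have F5m : (weilMarkovConstant a + weilGroundEnergy a) * ∫ x, ‖(χ x : ℂ) * u x‖ ^ 2 =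
      (weilMarkovConstant a + weilGroundEnergy a) * ((∫ x, ‖u x‖ ^ 2) +
        (∫ x, ‖((1 - χ x : ℝ) : ℂ) * u x‖ ^ 2) -
        2 * (∫ x, u x * conj (((1 - χ x : ℝ) : ℂ) * u x)).re) := by
    rw [F5']
  rw [hinner] at F8
  -- IMS: prime part, archimedean part, pole part
  have F9a : (∑ n ∈ weilPrimeIndex a, (Λ n : ℝ) / Real.sqrt n *
        weilIncrement (fun x ↦ ((1 - χ x : ℝ) : ℂ) * u x) (Real.log n)) -
      (∑ n ∈ weilPrimeIndex a, (Λ n : ℝ) / Real.sqrt n *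
        (∫ x, (u (x + Real.log n) - u x) * conj ((((1 - χ (x + Real.log n)) ^ 2 : ℝ) : ℂ) *
          u (x + Real.log n) - (((1 - χ x) ^ 2 : ℝ) : ℂ) * u x)).re) ≤
      ∑ n ∈ weilPrimeIndex a, (Λ n : ℝ) / Real.sqrt n *
        ∫ x, (χ (x + Real.log n) - χ x) ^ 2 * (‖u (x + Real.log n)‖ * ‖u x‖) := by
    rw [← Finset.sum_sub_distrib]
    refine Finset.sum_le_sum fun n _ ↦ ?_
    rw [← mul_sub]
    exact mul_le_mul_of_nonneg_left (stub_localizedCut_ims_increment hu hχc h01 (Real.log n))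
      (div_nonneg ArithmeticFunction.vonMangoldt_nonneg (Real.sqrt_nonneg _))
  have F9b : (∫ t in Ioi (0 : ℝ), weilArchDensity t *
        weilIncrement (fun x ↦ ((1 - χ x : ℝ) : ℂ) * u x) t) -
      (∫ t in Ioi (0 : ℝ), (weilArchDensity t : ℂ) *
        ∫ x, (u (x + t) - u x) * conj ((((1 - χ (x + t)) ^ 2 : ℝ) : ℂ) * u (x + t) -
          (((1 - χ x) ^ 2 : ℝ) : ℂ) * u x)).re ≤
      ∫ t in Ioi (0 : ℝ), weilArchDensity t *
        ∫ x, (χ (x + t) - χ x) ^ 2 * (‖u (x + t)‖ * ‖u x‖) := by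
    have hpol := stub_localizedCut_integrableOn_polar hu hθ2m hfinU hfinθ2
    have hconv := stub_localizedCut_re_setIntegral hpol
    beta_reduce at hconv
    rw [hconv]
    have hre : IntegrableOn (fun t ↦ weilArchDensity t *
        (∫ x, (u (x + t) - u x) * conj ((((1 - χ (x + t)) ^ 2 : ℝ) : ℂ) * u (x + t) -
          (((1 - χ x) ^ 2 : ℝ) : ℂ) * u x)).re) (Ioi 0) :=
      (stub_localizedCut_integrable_re hpol).congr (ae_of_all _ fun t ↦ by
        simp only [Complex.re_ofReal_mul])
    rw [← integral_sub hfinθ hre]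
    refine integral_mono_ae (hfinθ.sub hre)
      (stub_localizedCut_integrableOn_comm hu hχc h01 hK hχL) ?_
    refine (ae_restrict_iff' measurableSet_Ioi).2 (ae_of_all _ fun t (ht : 0 < t) ↦ ?_)
    beta_reduce
    rw [← mul_sub]
    exact mul_le_mul_of_nonneg_left (stub_localizedCut_ims_increment hu hχc h01 t)
      (weilArchDensity_pos ht).le
  have F9 : weilDirichletEnergy a (fun x ↦ ((1 - χ x : ℝ) : ℂ) * u x) =
      (∑ n ∈ weilPrimeIndex a, (Λ n : ℝ) / Real.sqrt n *
        weilIncrement (fun x ↦ ((1 - χ x : ℝ) : ℂ) * u x) (Real.log n)) +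
      ∫ t in Ioi (0 : ℝ), weilArchDensity t *
        weilIncrement (fun x ↦ ((1 - χ x : ℝ) : ℂ) * u x) t := rfl
  have F10a := Complex.abs_re_le_norm (2 * (∫ x, u x * (Real.cosh (x / 2) : ℂ)) *
    conj (∫ x, (((1 - χ x) ^ 2 : ℝ) : ℂ) * u x * (Real.cosh (x / 2) : ℂ)))
  have F10b := Complex.abs_re_le_norm (2 * (∫ x, u x * (Real.sinh (x / 2) : ℂ)) *
    conj (∫ x, (((1 - χ x) ^ 2 : ℝ) : ℂ) * u x * (Real.sinh (x / 2) : ℂ)))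
  rw [norm_mul, norm_mul, Complex.norm_conj, Complex.norm_two, abs_le] at F10a F10b
  have F10c : weilPoleForm (fun x ↦ ((1 - χ x : ℝ) : ℂ) * u x) =
      2 * ‖∫ t, ((1 - χ t : ℝ) : ℂ) * u t * (Real.cosh (t / 2) : ℂ)‖ ^ 2 -
        2 * ‖∫ t, ((1 - χ t : ℝ) : ℂ) * u t * (Real.sinh (t / 2) : ℂ)‖ ^ 2 := rfl
  have F10d := sq_nonneg ‖∫ t, ((1 - χ t : ℝ) : ℂ) * u t * (Real.sinh (t / 2) : ℂ)‖
  -- assemble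
  linarith [F1, F2, F3, F4, F5', F5m, F6, F7, F8, F9a, F9b, F9, F10a.1, F10a.2, F10b.1,
    F10b.2, F10c, F10d]

end Summit.RiemannHypothesis.RiemannHypothesis.Theorems.WeilWindowFlowWindowLipschitz

end
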